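import Summits.QuantumFields.BalabanUV.Beta.RelInvBorderedHessian
import Literature.MathematicalPhysics.QuantumFieldTheory.Balaban1983to89.Beta.RootedKernelReflection

/-!
# The ROOTED bordered Hessian `bhKAt ρ N` (constraint blocks = the rooted linearised averaging `q¹ = linAvgAt ρ δ`) and the
# COMB-STABILITY of the relative inverse: `RelInv G₀ (bhKAt (toSite r) Lc) (axEc (toSite r) Lc)` at `j = 0`
# (β sub-cell, row BETA-an2, gen 14; NOTE X-an2-45 §3, kernel item (R45-4)(i))

HONEST FRAMING (cell charter, verbatim): «discharging BetaPertH makes Balaban's UV stability UNCONDITIONAL — a real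
constructive-QFT result; it is NOT the continuum limit and NOT the Clay problem.»  DERIVED cell leaf (pub-balaban β sub-cell, lane
an2 gen 14); no statement of Bałaban's papers is typed here, no `[cite:]` tag, no `Prop` fact; it instantiates no binder of the
β-function wall by itself.  NOT `BetaPertH`; NOT continuum; NOT Clay.

## What is here

Gen 13 proved `RelInv G₀ (bhK Lc) (axEc ρ Lc)` for `G₀ = coDressKBmAt ρ Lc (KInvStep Lc 0)` against the STRAIGHT bordered Hessian
`bhK N = [[d*d, −𝒬ᵀ_N],[𝒬_N, 0]]`.  The product-chart reflection contact of the first-order spine is a commutator with the ROOTED bordered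
operator whose constraint blocks are the rooted linearised averaging `q¹ = linAvgAt ρ (δ_f)` (NOTE X-an2-45 §3, toy V2), which differs from
`𝒬_N` by the coarse exact form `dz Λ^ρ` — supported on COMB bonds.  This file types the rooted operator and shows the relative inverse does
not see the difference:
* §1 bridges: `single_one_eq_delta1`, `linAvgAt_delta1_eq_cast` (= an1's `linCountAt` in `ℝ`), **`linAvgAt_delta1_of_not_isCombBond`**
  (on a NON-comb bond the rooted and straight averagings of its indicator agree: gen 13's `axialGaugeAt_delta1_of_not_isCombBond`),
  `abs_linAvgAt_delta1_le`, `linAvgAt_delta1_eq_zero_of_not_near` (an1's bound and support box).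
* §2 **`bhKAt ρ N`** — `bhK N` with `(inr κ x; inl l y) := [proj N x = 0]·linAvgAt ρ (delta1 l y) N κ (quo N x)` and
  `(inl κ x; inr l y) := −[proj N y = 0]·linAvgAt ρ (delta1 κ x) N l (quo N y)`; entries, `bhKAt_eq_zero_of_not_mem_cube`, `abs_bhKAt_le`,
  `decays_bhKAt`, `spr_bhKAt`.
* §3 COMB-SUPPORTED PERTURBATIONS (every non-zero entry has a comb FIELD leg; an explicit hypothesis, no named `Prop`) ARE INVISIBLE TO THE
  RELATIVE INVERSE: `comp_comp_axEc_of_combSupported` (`(E∘Δ)∘A = 0` when `E∘A = A`), `comp_comp_of_combSupported_axEc`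
  (`(A∘Δ)∘E = 0` when `A∘E = A`), **`relInv_of_combSupported_sub`** (`RelInv A M E`, `M′ − M` comb-supported ⟹ `RelInv A M′ E`, `E = axEc ρ N`).
* §4–§5 **`combSupported_bhKAt_sub_bhK`**, `relInv_coDressKBmAt_KInv_bhKAt`, and **`relInv_coDressKBmAt_KInvStep_zero_bhKAt (hr) :
  RelInv (coDressKBmAt (toSite r) Lc (KInvStep Lc 0)) (bhKAt (toSite r) Lc) (axEc (toSite r) Lc)`** — rules 1–4 at `j = 0` for the ROOTED
  bordered Hessian, every in-block root, every dimension.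

All declarations `[folklore]`; axioms standard.  Provenance: b2b-balaban β sub-cell, unit beta-an2 gen 14, 2026-08-20 (v1); over
`RelInvBorderedHessian` (an2 gen 13), an1's `AveragingHessianKernelsRooted` / `AveragingContoursRooted`, an5's `RootedKernelReflection`
(`cast_linCountAt`) BY NAME; no existing file touched.
-/

open Finset
open scoped BigOperators
open Literature.Probability.LatticeModels (TorusSite Torus.proj Torus.proj_apply)
open Literature.MathematicalPhysics.QuantumFieldTheory
open Literature.MathematicalPhysics.QuantumFieldTheory.Balaban1983to89
open Literature.MathematicalPhysics.QuantumFieldTheory.Balaban1983to89.Beta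
open B12Sec2to5 (l1 l1_nonneg)
open ExpKernelCalculus (MKer Decays BiLoc comp tr shiftK)
open AffineAveraging (Form0 Form1 Form2 box toSite unitVec unitVec_apply dz curv curvAdj codiff₁ contourSum)
open AffineReproduction (contourSumAdj)
open AveragingContours (straightSum_eq_contourSum)
open AveragingContoursRooted (AxialGaugeAt linAvgAt linAvgAt_eq_straightSum_of_axialGaugeAt)
open AveragingHessianKernels (Bond single single_apply Near ell)
open AveragingHessianKernelsRooted (linCountAt linCountAt_eq_zero abs_linCountAt_le)
open RootedKernelReflection (cast_linCountAt)
open KKTFluctuationKernel (delta1 delta1_apply)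
open LatticeForm (quo)
open OneStepResolventKernel (Fib KInv quo_zsmul eq_zsmul_quo_of_proj proj_zsmul)
open OneStepKernelFamily (KInvStep)
open HessKerRate (decays_sub)
open Summit.QuantumFields.BalabanUV.Beta.TameKernelCalculus
open Summit.QuantumFields.BalabanUV.Beta.ChartConjugationRelative (RelInv)
open Summit.QuantumFields.BalabanUV.Beta.AxialDressingRooted (cube mem_cube l1_le_of_mem_cube coDressKBmAt spr_coDressKBmAt one_le_of_neZero
  IsCombBondAt axEc comp_axEc_apply comp_axEc_apply' spr_axEc spr_comp)

namespace Summit.QuantumFields.BalabanUV.Beta.BorderedHessian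

noncomputable section

variable {d : ℕ}

/-! ## §1 Bridges: the rooted linearised averaging of a bond indicator -/

section Bridges
/-- [folklore] an1's unit single-bond form is an2's `delta1`. -/
theorem single_one_eq_delta1 (l : Fin (d + 1)) (y : Fin (d + 1) → ℤ) : single (l, y) (1 : ℝ) = delta1 l y := by
  funext κ x
  rw [single_apply, delta1_apply]
  by_cases h : κ = l ∧ x = y
  · rw [if_pos (Prod.ext h.1 h.2), if_pos h]
  · rw [if_neg (fun e => h ⟨(Prod.mk.inj e).1, (Prod.mk.inj e).2⟩), if_neg h]

/-- [folklore] The rooted linearised averaging of a bond indicator is an1's integer count `linCountAt`, read in `ℝ`. -/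
theorem linAvgAt_delta1_eq_cast (ρ : Fin (d + 1) → ℤ) (N : ℕ) (l : Fin (d + 1)) (y : Fin (d + 1) → ℤ) (κ : Fin (d + 1))
    (y' : Fin (d + 1) → ℤ) : linAvgAt ρ (delta1 l y) N κ y' = ((linCountAt ρ N κ y' (l, y) : ℤ) : ℝ) := by
  rw [cast_linCountAt, single_one_eq_delta1]

/-- [folklore] **ON A NON-COMB BOND THE ROOTED AND THE STRAIGHT LINEARISED AVERAGINGS OF ITS INDICATOR AGREE** (in-block root): the
indicator is in the rooted axial gauge, so the comb correction `dz Λ^ρ` vanishes. -/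
theorem linAvgAt_delta1_of_not_isCombBond {N : ℕ} (hN : 1 ≤ N) {r : Fin (d + 1) → ℕ} (hr : r ∈ box (d + 1) N) {l : Fin (d + 1)}
    {y : Fin (d + 1) → ℤ} (hc : ¬ IsCombBondAt (toSite r) N l y) (κ : Fin (d + 1)) (y' : Fin (d + 1) → ℤ) :
    linAvgAt (toSite r) (delta1 l y) N κ y' = contourSum N (delta1 l y) κ y' := by
  rw [linAvgAt_eq_straightSum_of_axialGaugeAt (axialGaugeAt_delta1_of_not_isCombBond hN hr hc), straightSum_eq_contourSum]

/-- [folklore] Bound: `|linAvgAt ρ (delta1 l y) N κ y′| ≤ N^{d+1}·ℓ` (in-block root; an1's `abs_linCountAt_le`). -/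
theorem abs_linAvgAt_delta1_le {N : ℕ} (hN : 1 ≤ N) {r : Fin (d + 1) → ℕ} (hr : r ∈ box (d + 1) N) (l : Fin (d + 1))
    (y : Fin (d + 1) → ℤ) (κ : Fin (d + 1)) (y' : Fin (d + 1) → ℤ) :
    |linAvgAt (toSite r) (delta1 l y) N κ y'| ≤ (N : ℝ) ^ (d + 1) * ell (d + 1) N := by
  rw [linAvgAt_delta1_eq_cast, ← Int.cast_abs]
  have h := abs_linCountAt_le hN κ y' hr (l, y)
  exact_mod_cast h

/-- [folklore] Support: the rooted averaging of the indicator of `(l, y)` at the coarse bond `(κ, y′)` vanishes unless `y` is in the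
support box of `y′` (an1's `linCountAt_eq_zero`). -/
theorem linAvgAt_delta1_eq_zero_of_not_near {N : ℕ} {r : Fin (d + 1) → ℕ} (hr : r ∈ box (d + 1) N) (l : Fin (d + 1))
    {y : Fin (d + 1) → ℤ} (κ : Fin (d + 1)) {y' : Fin (d + 1) → ℤ} (h : ¬ Near N y' y) :
    linAvgAt (toSite r) (delta1 l y) N κ y' = 0 := by
  rw [linAvgAt_delta1_eq_cast, linCountAt_eq_zero hr (f := (l, y)) h, Int.cast_zero]
end Bridges

/-! ## §2 The rooted bordered Hessian -/

section Def
variable (d)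

open Classical in
/-- [folklore] **THE ROOTED BORDERED HESSIAN** `bhKAt ρ N`: `bhK N` with the straight constraint blocks `±𝒬_N` replaced by the ROOTED
linearised averaging of bond indicators (`q¹` in an1's letters): `(inr κ x; inl l y) = [proj N x = 0]·linAvgAt ρ (delta1 l y) N κ (quo N x)`,
`(inl κ x; inr l y) = −[proj N y = 0]·linAvgAt ρ (delta1 κ x) N l (quo N y)`; field–field block = the windowed `d*d` of `bhK`;
multiplier–multiplier block `0`. -/
def bhKAt (ρ : Fin (d + 1) → ℤ) (N : ℕ) : MKer (d + 1) (Fib d) :=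
  fun x y a b =>
    match a, b with
    | Sum.inl κ, Sum.inl l => if y - x ∈ cube (d + 1) 2 then curvAdj (curv (delta1 l y)) κ x else 0
    | Sum.inl κ, Sum.inr l => if Torus.proj N y = 0 then -(linAvgAt ρ (delta1 κ x) N l (quo N y)) else 0
    | Sum.inr κ, Sum.inl l => if Torus.proj N x = 0 then linAvgAt ρ (delta1 l y) N κ (quo N x) else 0
    | Sum.inr _, Sum.inr _ => 0

variable {d} (ρ : Fin (d + 1) → ℤ) (N : ℕ)

/-- [folklore] The field–field block of `bhKAt` is that of `bhK`. -/
theorem bhKAt_inl_inl (x y : Fin (d + 1) → ℤ) (κ l : Fin (d + 1)) :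
    bhKAt d ρ N x y (Sum.inl κ) (Sum.inl l) = bhK N x y (Sum.inl κ) (Sum.inl l) := rfl

open Classical in
/-- [folklore] Field–multiplier entry of `bhKAt`. -/
theorem bhKAt_inl_inr (x y : Fin (d + 1) → ℤ) (κ l : Fin (d + 1)) :
    bhKAt d ρ N x y (Sum.inl κ) (Sum.inr l) = if Torus.proj N y = 0 then -(linAvgAt ρ (delta1 κ x) N l (quo N y)) else 0 := rfl

open Classical in
/-- [folklore] Multiplier–field entry of `bhKAt`. -/
theorem bhKAt_inr_inl (x y : Fin (d + 1) → ℤ) (κ l : Fin (d + 1)) :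
    bhKAt d ρ N x y (Sum.inr κ) (Sum.inl l) = if Torus.proj N x = 0 then linAvgAt ρ (delta1 l y) N κ (quo N x) else 0 := rfl

/-- [folklore] Multiplier–multiplier entry of `bhKAt` vanishes. -/
theorem bhKAt_inr_inr (x y : Fin (d + 1) → ℤ) (κ l : Fin (d + 1)) : bhKAt d ρ N x y (Sum.inr κ) (Sum.inr l) = 0 := rfl

variable {ρ N}

/-- [folklore] The support box of a coarse point lies in the window `cube (2N)` around it. -/
theorem sub_mem_cube_of_near {N : ℕ} [NeZero N] {y x : Fin (d + 1) → ℤ} (hx : Torus.proj N x = 0) (h : Near N (quo N x) y) :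
    y - x ∈ cube (d + 1) (2 * N) := by
  rw [mem_cube]
  intro i
  have hxe : x i = (N : ℤ) * quo N x i := by
    have := congrFun (eq_zsmul_quo_of_proj (N := N) hx) i
    simpa [Pi.smul_apply, smul_eq_mul] using this
  obtain ⟨h1, h2⟩ := h i
  rw [Pi.sub_apply, abs_le]
  push_cast
  constructor <;> omega

/-- [folklore] **FINITE RANGE**: `bhKAt (toSite r) N x y a b = 0` unless `y − x ∈ cube (2N)` (in-block root, `N ≥ 1`). -/
theorem bhKAt_eq_zero_of_not_mem_cube {N : ℕ} [NeZero N] (hN : 1 ≤ N) {r : Fin (d + 1) → ℕ} (hr : r ∈ box (d + 1) N) {x y : Fin (d + 1) → ℤ}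
    (hxy : y - x ∉ cube (d + 1) (2 * N)) (a b : Fib d) : bhKAt d (toSite r) N x y a b = 0 := by
  rcases a with κ | κ <;> rcases b with l | l
  · rw [bhKAt_inl_inl]; exact bhK_eq_zero_of_not_mem_cube hN hxy _ _
  · rw [bhKAt_inl_inr]
    split_ifs with hy
    · rw [neg_eq_zero]
      refine linAvgAt_delta1_eq_zero_of_not_near hr κ l fun hnear => hxy ?_
      have h := sub_mem_cube_of_near hy hnear
      rw [mem_cube] at h ⊢
      intro i
      have := h i
      rw [Pi.sub_apply] at this ⊢
      rw [abs_sub_comm]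
      exact this
    · rfl
  · rw [bhKAt_inr_inl]
    split_ifs with hx
    · exact linAvgAt_delta1_eq_zero_of_not_near hr l κ fun hnear => hxy (sub_mem_cube_of_near hx hnear)
    · rfl
  · rfl

/-- [folklore] Uniform entry bound of `bhKAt`. -/
def cBHA (d N : ℕ) : ℝ := cBH d N + (N : ℝ) ^ (d + 1) * ell (d + 1) N

/-- [folklore] `0 ≤ cBHA d N`. -/
theorem cBHA_nonneg (d N : ℕ) : 0 ≤ cBHA d N := by unfold cBHA; exact add_nonneg (cBH_nonneg d N) (by positivity)

/-- [folklore] Every entry of `bhKAt (toSite r) N` is bounded by `cBHA d N` (in-block root, `N ≥ 1`). -/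
theorem abs_bhKAt_le {N : ℕ} (hN : 1 ≤ N) {r : Fin (d + 1) → ℕ} (hr : r ∈ box (d + 1) N) (x y : Fin (d + 1) → ℤ) (a b : Fib d) :
    |bhKAt d (toSite r) N x y a b| ≤ cBHA d N := by
  have h1 : (0 : ℝ) ≤ cBH d N := cBH_nonneg d N
  have h2 : (0 : ℝ) ≤ (N : ℝ) ^ (d + 1) * ell (d + 1) N := by positivity
  unfold cBHA
  rcases a with κ | κ <;> rcases b with l | l
  · rw [bhKAt_inl_inl]; exact (abs_bhK_le N x y _ _).trans (le_add_of_nonneg_right h2)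
  · rw [bhKAt_inl_inr]
    split_ifs
    · rw [abs_neg]; exact (abs_linAvgAt_delta1_le hN hr κ x l _).trans (le_add_of_nonneg_left h1)
    · rw [abs_zero]; exact add_nonneg h1 h2
  · rw [bhKAt_inr_inl]
    split_ifs
    · exact (abs_linAvgAt_delta1_le hN hr l y κ _).trans (le_add_of_nonneg_left h1)
    · rw [abs_zero]; exact add_nonneg h1 h2
  · rw [bhKAt_inr_inr, abs_zero]; exact add_nonneg h1 h2

/-- [folklore] **`bhKAt (toSite r) N` DECAYS AT EVERY RATE** (finite range, bounded entries). -/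
theorem decays_bhKAt {N : ℕ} [NeZero N] (hN : 1 ≤ N) {r : Fin (d + 1) → ℕ} (hr : r ∈ box (d + 1) N) {δ : ℝ} (hδ : 0 ≤ δ) :
    Decays (bhKAt d (toSite r) N) (cBHA d N * Real.exp (δ * (((d : ℝ) + 1) * (2 * N)))) δ := by
  intro x y a b
  by_cases hxy : y - x ∈ cube (d + 1) (2 * N)
  · have hl : l1 (x - y) ≤ ((d : ℝ) + 1) * (2 * N) := by
      rw [ExpKernelCalculus.l1_sub_symm]
      have := l1_le_of_mem_cube hxy
      push_cast at this
      linarith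
    calc |bhKAt d (toSite r) N x y a b| ≤ cBHA d N * 1 := by rw [mul_one]; exact abs_bhKAt_le hN hr x y a b
      _ ≤ cBHA d N * (Real.exp (δ * (((d : ℝ) + 1) * (2 * N))) * Real.exp (-δ * l1 (x - y))) := by
          refine mul_le_mul_of_nonneg_left ?_ (cBHA_nonneg d N)
          rw [← Real.exp_add]
          exact Real.one_le_exp (by nlinarith)
      _ = cBHA d N * Real.exp (δ * (((d : ℝ) + 1) * (2 * N))) * Real.exp (-δ * l1 (x - y)) := by ring
  · rw [bhKAt_eq_zero_of_not_mem_cube hN hr hxy, abs_zero]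
    exact mul_nonneg (mul_nonneg (cBHA_nonneg d N) (Real.exp_pos _).le) (Real.exp_pos _).le

/-- [folklore] **`bhKAt (toSite r) N` IS SPREAD**. -/
theorem spr_bhKAt {N : ℕ} [NeZero N] (hN : 1 ≤ N) {r : Fin (d + 1) → ℕ} (hr : r ∈ box (d + 1) N) : Spr (bhKAt d (toSite r) N) :=
  ⟨_, 1, one_pos, decays_bhKAt hN hr zero_le_one⟩
end Def

/-! ## §3 Comb-supported perturbations are invisible to the relative inverse -/

section Comb
variable {ρ : Fin (d + 1) → ℤ} {N : ℕ}

/-! A kernel `Δ` is COMB-SUPPORTED when every non-zero entry has a FIELD leg on a comb bond (row or column):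
`∀ x y a b, Δ x y a b ≠ 0 → (∃ κ, a = inl κ ∧ IsCombBondAt ρ N κ x) ∨ (∃ l, b = inl l ∧ IsCombBondAt ρ N l y)` — kept as an explicit
hypothesis below (no named `Prop`). -/

/-- [folklore] A kernel fixed by `axEc` on the LEFT has no field rows on comb bonds. -/
theorem apply_eq_zero_of_comp_axEc_left {A : MKer (d + 1) (Fib d)} (hEA : comp (axEc ρ N) A = A) {κ : Fin (d + 1)}
    {x : Fin (d + 1) → ℤ} (hc : IsCombBondAt ρ N κ x) (y : Fin (d + 1) → ℤ) (b : Fib d) : A x y (Sum.inl κ) b = 0 := by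
  have h := congrFun (congrFun (congrFun (congrFun hEA x) y) (Sum.inl κ)) b
  rw [comp_axEc_apply] at h
  simp only [if_pos hc] at h
  exact h.symm

/-- [folklore] A kernel fixed by `axEc` on the RIGHT has no field columns on comb bonds. -/
theorem apply_eq_zero_of_comp_axEc_right {A : MKer (d + 1) (Fib d)} (hAE : comp A (axEc ρ N) = A) (x : Fin (d + 1) → ℤ) (a : Fib d)
    {l : Fin (d + 1)} {y : Fin (d + 1) → ℤ} (hc : IsCombBondAt ρ N l y) : A x y a (Sum.inl l) = 0 := by
  have h := congrFun (congrFun (congrFun (congrFun hAE x) y) a) (Sum.inl l)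
  rw [comp_axEc_apply'] at h
  simp only [if_pos hc] at h
  exact h.symm

open Classical in
/-- [folklore] **`(E∘Δ)∘A = 0`** for a comb-supported `Δ` and an `A` with `E∘A = A` (`E = axEc ρ N`): termwise. -/
theorem comp_comp_axEc_of_combSupported {Δ A : MKer (d + 1) (Fib d)} (hΔ : ∀ x y a b, Δ x y a b ≠ 0 → (∃ κ, a = Sum.inl κ ∧ IsCombBondAt ρ N κ x) ∨ (∃ l, b = Sum.inl l ∧ IsCombBondAt ρ N l y))
    (hEA : comp (axEc ρ N) A = A) :
    comp (comp (axEc ρ N) Δ) A = 0 := by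
  funext x z a c
  unfold ExpKernelCalculus.comp
  rw [Pi.zero_apply, Pi.zero_apply, Pi.zero_apply, Pi.zero_apply]
  refine (tsum_congr fun y => ?_).trans tsum_zero
  refine Finset.sum_eq_zero fun b _ => ?_
  -- the inner factor `(E∘Δ) x y a b`, unfolded by the left-action lemma
  have hE : (comp (axEc ρ N) Δ) x y a b = (match a with
      | Sum.inl α => if IsCombBondAt ρ N α x then 0 else Δ x y a b
      | Sum.inr _ => if Torus.proj N x = 0 then Δ x y a b else 0) := comp_axEc_apply ρ N Δ x y a b
  by_cases hz : Δ x y a b = 0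
  · have : comp (axEc ρ N) Δ x y a b = 0 := by
      rw [hE]; rcases a with α | m <;> simp [hz]
    unfold ExpKernelCalculus.comp at this
    rw [this, zero_mul]
  · rcases hΔ x y a b hz with ⟨κ, rfl, hc⟩ | ⟨l, rfl, hc⟩
    · have : comp (axEc ρ N) Δ x y (Sum.inl κ) b = 0 := by rw [hE]; simp only [if_pos hc]
      unfold ExpKernelCalculus.comp at this
      rw [this, zero_mul]
    · rw [apply_eq_zero_of_comp_axEc_left hEA hc, mul_zero]

open Classical in
/-- [folklore] **`(A∘Δ)∘E = 0`** for a comb-supported `Δ` and an `A` with `A∘E = A` (`E = axEc ρ N`): termwise. -/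
theorem comp_comp_of_combSupported_axEc {Δ A : MKer (d + 1) (Fib d)} (hΔ : ∀ x y a b, Δ x y a b ≠ 0 → (∃ κ, a = Sum.inl κ ∧ IsCombBondAt ρ N κ x) ∨ (∃ l, b = Sum.inl l ∧ IsCombBondAt ρ N l y))
    (hAE : comp A (axEc ρ N) = A) :
    comp (comp A Δ) (axEc ρ N) = 0 := by
  funext x z a c
  rw [comp_axEc_apply']
  have hz : comp A Δ x z a c = 0 ∨ (∃ l, c = Sum.inl l ∧ IsCombBondAt ρ N l z) := by
    by_cases hcomb : ∃ l, c = Sum.inl l ∧ IsCombBondAt ρ N l z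
    · exact Or.inr hcomb
    · left
      unfold ExpKernelCalculus.comp
      refine (tsum_congr fun y => ?_).trans tsum_zero
      refine Finset.sum_eq_zero fun b _ => ?_
      by_cases h0 : Δ y z b c = 0
      · rw [h0, mul_zero]
      · rcases hΔ y z b c h0 with ⟨κ, rfl, hc⟩ | hc
        · rw [apply_eq_zero_of_comp_axEc_right hAE x a hc, zero_mul]
        · exact absurd hc hcomb
  rcases c with β | m
  · by_cases hc : IsCombBondAt ρ N β z
    · simp only [if_pos hc]; rfl
    · simp only [if_neg hc]
      rcases hz with h | ⟨l, hl, hc'⟩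
      · rw [h]; rfl
      · rw [Sum.inl.injEq] at hl; subst hl; exact absurd hc' hc
  · rcases hz with h | ⟨l, hl, _⟩
    · split_ifs
      · rw [h]; rfl
      · rfl
    · exact absurd hl (by simp)

/-- [folklore] The difference of two spread kernels is spread. -/
theorem spr_sub {M M' : MKer (d + 1) (Fib d)} (hM : Spr M) (hM' : Spr M') : Spr (M' - M) := by
  obtain ⟨C, δ, hδ, h⟩ := hM
  obtain ⟨C', δ', hδ', h'⟩ := hM'
  refine ⟨|C'| + |C|, min δ δ', lt_min hδ hδ', ?_⟩
  exact decays_sub (decays_of_le h' (min_le_right _ _)) (decays_of_le h (min_le_left _ _))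

/-- [folklore] **COMB-STABILITY OF THE RELATIVE INVERSE**: if `RelInv A M (axEc ρ N)` and `M′ − M` is comb-supported (`A, M, M′`
spread), then `RelInv A M′ (axEc ρ N)`. -/
theorem relInv_of_combSupported_sub {A M M' : MKer (d + 1) (Fib d)} (hA : Spr A) (hM : Spr M) (hM' : Spr M')
    (hR : RelInv A M (axEc ρ N))
    (hΔ : ∀ x y a b, (M' - M) x y a b ≠ 0 → (∃ κ, a = Sum.inl κ ∧ IsCombBondAt ρ N κ x) ∨ (∃ l, b = Sum.inl l ∧ IsCombBondAt ρ N l y)) :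
    RelInv A M' (axEc ρ N) := by
  obtain ⟨hEA, hAE, h3, h4⟩ := hR
  have hE : Spr (axEc (d := d) ρ N) := spr_axEc ρ N
  have hD : Spr (M' - M) := spr_sub hM hM'
  have eA : comp A M' = comp A M + comp A (M' - M) := by
    rw [comp_sub_right_tame hA.tame hM'.tame hM.tame]; abel
  have eE : comp (axEc ρ N) M' = comp (axEc ρ N) M + comp (axEc ρ N) (M' - M) := by
    rw [comp_sub_right_tame hE.tame hM'.tame hM.tame]; abel
  refine ⟨hEA, hAE, ?_, ?_⟩
  · rw [eA, comp_add_left_tame (spr_comp hA hM).tame (spr_comp hA hD).tame hE.tame, h3,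
      comp_comp_of_combSupported_axEc hΔ hAE, add_zero]
  · rw [eE, comp_add_left_tame (spr_comp hE hM).tame (spr_comp hE hD).tame hA.tame, h4,
      comp_comp_axEc_of_combSupported hΔ hEA, add_zero]
end Comb

/-! ## §4 The rooted bordered Hessian differs from the straight one on comb bonds only -/

section Rooted
variable {N : ℕ} [NeZero N] {r : Fin (d + 1) → ℕ}

/-- [folklore] **`bhKAt − bhK` IS COMB-SUPPORTED** (in-block root): off the comb bonds the rooted and straight averagings of a bond
indicator agree (`linAvgAt_delta1_of_not_isCombBond`, `contourSum_delta1_eq_contourSumAdj`). -/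
theorem combSupported_bhKAt_sub_bhK (hr : r ∈ box (d + 1) N) (x y : Fin (d + 1) → ℤ) (a b : Fib d)
    (hne : (bhKAt d (toSite r) N - bhK (d := d) N) x y a b ≠ 0) :
    (∃ κ, a = Sum.inl κ ∧ IsCombBondAt (toSite r) N κ x) ∨ (∃ l, b = Sum.inl l ∧ IsCombBondAt (toSite r) N l y) := by
  have hN : 1 ≤ N := one_le_of_neZero N
  rw [Pi.sub_apply, Pi.sub_apply, Pi.sub_apply, Pi.sub_apply] at hne
  rcases a with κ | κ <;> rcases b with l | l
  · exact absurd (by rw [bhKAt_inl_inl, sub_self]) hne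
  · by_cases hc : IsCombBondAt (toSite r) N κ x
    · exact Or.inl ⟨κ, rfl, hc⟩
    · refine absurd ?_ hne
      rw [bhKAt_inl_inr, bhK_inl_inr]
      split_ifs with hy
      · rw [linAvgAt_delta1_of_not_isCombBond hN hr hc, contourSum_delta1_eq_contourSumAdj, sub_self]
      · rw [sub_self]
  · by_cases hc : IsCombBondAt (toSite r) N l y
    · exact Or.inr ⟨l, rfl, hc⟩
    · refine absurd ?_ hne
      rw [bhKAt_inr_inl, bhK_inr_inl]
      split_ifs with hx
      · rw [linAvgAt_delta1_of_not_isCombBond hN hr hc, sub_self]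
      · rw [sub_self]
  · exact absurd (by rw [bhKAt_inr_inr, bhK_inr_inr, sub_self]) hne

/-- [folklore] **`RelInv G (bhKAt (toSite r) N) (axEc (toSite r) N)` AT THE ONE-STEP LEVEL**, `G := coDressKBmAt (toSite r) N (KInv N)` —
gen 13's straight relative inverse transported along the comb-supported difference. -/
theorem relInv_coDressKBmAt_KInv_bhKAt (hr : r ∈ box (d + 1) N) :
    RelInv (coDressKBmAt (toSite r) N (KInv (N := N) (d := d))) (bhKAt d (toSite r) N) (axEc (toSite r) N) := by
  have hN : 1 ≤ N := one_le_of_neZero N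
  exact relInv_of_combSupported_sub (spr_coDressKBmAt hN hr (spr_KInv (N := N) (d := d))) (spr_bhK hN) (spr_bhKAt hN hr)
    (relInv_coDressKBmAt_KInv hr) (combSupported_bhKAt_sub_bhK hr)
end Rooted

/-! ## §5 The `j = 0` instance of the step family -/

section StepZero
variable {Lc : ℕ} [NeZero Lc] {r : Fin (d + 1) → ℕ}

/-- [folklore] **`RelInv G₀ (bhKAt (toSite r) Lc) (axEc (toSite r) Lc)`** for `G₀ := coDressKBmAt (toSite r) Lc (KInvStep Lc 0)`: rules 1–4
at `j = 0` against the ROOTED bordered Hessian — the `𝕄 0` against which the product-chart reflection contact is an exact commutator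
(NOTE X-an2-45 §3). -/
theorem relInv_coDressKBmAt_KInvStep_zero_bhKAt (hr : r ∈ box (d + 1) Lc) :
    RelInv (coDressKBmAt (toSite r) Lc (KInvStep (d := d) Lc 0)) (bhKAt d (toSite r) Lc) (axEc (toSite r) Lc) := by
  rw [KInvStep_zero_eq]; exact relInv_coDressKBmAt_KInv_bhKAt hr
end StepZero

end
end Summit.QuantumFields.BalabanUV.Beta.BorderedHessian
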